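import Summits.QuantumFields.YangMills.Theorems.FemtoCurvatureTwoPoint.Negative.FiniteGroupBounds
import Literature.Barriers.QuantumFields.DiscreteSubgroupFreezing

/-!
# `FemtoCurvatureTwoPoint` — finite abelian gauge group: exponential RATES of the axis pair
# (`O(ε⁸)`) and of the shared-link pair (`Ω(ε⁶)`) as `β → ∞` (support for `Negative.FiniteGroupFalse`)

Negative-side support for crux `Summit.QuantumFields.YangMills.Theses.LangevinControlUV.
FemtoCurvatureTwoPoint` (item stmt-QuantumFields-9363; cdisprove gen 1 mechanism, gen 2 landing).

`eventually_rates`: for a finite abelian non-trivial gauge group `G` with a faithful unitary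
representation `ρ` and Wilson's measure on the torus `(ℤ/8)⁴` there are `δ > 0` (the minimal
action gap of `ρ`) and `M₁, M₂ ≥ 0` such that for all large `β`, with `ε = e^{-βδ}`:
`Cov_β(P_0^{01}, P_{e₂}^{01}) ≤ M₁ ε⁸` (axis pair: two-vortex Peierls bound,
`Negative.FiniteGroupBounds.sum_Img_axis_le`) and
`δ² ε⁶ / 2 - M₂ ε⁸ ≤ Cov_β(P_0^{02}, P_{e₂}^{01})` (shared-link pair: single-link excitation,
`sum_Img_pair_ge`), `P_x^{ij} = N - Re tr ρ(U_{p(x;i,j)})`. The two pairs have the same torus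
distance `1`, so the RATES differ (`ε⁸` against `ε⁶`) where the crux's shared shape function
allows only a constant factor — the capstone `Negative.FiniteGroupFalse` draws the conclusion.

This is the explicit-rate form of `Negative.FiniteGroupRatio.eventually_ratio_blowup` (p79223; same
proof, the comparison step left to the user). That module was accepted but its hub build never
landed (`remote:stale:…:unbuilt` for > 10 h — the reason the six gen-1 capstone submissions
importing it bounced "gate restarted"), so the capstone imports THIS module instead.
-/

noncomputable section

open Finset Function Filter Topology
open Literature.MathematicalPhysics.QuantumFieldTheory
open Literature.MathematicalPhysics.QuantumFieldTheory.LatticeForm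
open Literature.Probability.LatticeModels (rcomponent rcomponents)
open Summit.QuantumFields.YangMills.Theorems.FemtoCurvatureTwoPoint.Negative.FiniteGroupPeierls
open Summit.QuantumFields.YangMills.Theorems.FemtoCurvatureTwoPoint.Negative.FiniteGroupVortices
open Summit.QuantumFields.YangMills.Theorems.FemtoCurvatureTwoPoint.Negative.FiniteGroupTwoPlaquettes
open Summit.QuantumFields.YangMills.Theorems.FemtoCurvatureTwoPoint.Negative.FiniteGroupBounds

namespace Summit.QuantumFields.YangMills.Theorems.FemtoCurvatureTwoPoint.Negative.FiniteGroupSharedLink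

/- At the concrete torus `L = 8` the unifier must never unfold the finsets over all plaquettes /
configurations. -/
attribute [local irreducible] psupp Closed Fib connSets Wt Img

variable {G : Type} [CommGroup G] [Fintype G] [DecidableEq G] [TopologicalSpace G]
  [DiscreteTopology G] [IsTopologicalGroup G] [MeasurableSpace G] [BorelSpace G] {N : ℕ}
  (ρ : G →* Matrix (Fin N) (Fin N) ℂ)

/-- **Exponential rates of the two covariances.** For a finite abelian non-trivial `G` and a
faithful unitary `ρ` there are `δ > 0` (the minimal action gap) and `M₁, M₂ ≥ 0` such that for all
large `β`, with `ε = e^{-βδ}`: the axis covariance is `≤ M₁ ε⁸` and the shared-link covariance is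
`≥ δ² ε⁶ / 2 - M₂ ε⁸`. -/
theorem eventually_rates [Nontrivial G] (hρu : ∀ g, ρ g ∈ Matrix.unitaryGroup (Fin N) ℂ)
    (hρinj : Function.Injective ρ) :
    ∃ (δ M₁ M₂ : ℝ), 0 < δ ∧ 0 ≤ M₁ ∧ 0 ≤ M₂ ∧ ∀ᶠ β : ℝ in atTop,
      wilsonExpectation (d := 4) (L := 8) ρ β (fun U =>
            ((N : ℝ) - (ρ (plaquetteHolonomy U (0 : Site 4 8) 0 1)).trace.re) *
              ((N : ℝ) - (ρ (plaquetteHolonomy U (Pi.single (2 : Fin 4) (((1 : ℕ) : ℕ) : ZMod 8))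
                0 1)).trace.re)) -
          wilsonExpectation (d := 4) (L := 8) ρ β
              (fun U => (N : ℝ) - (ρ (plaquetteHolonomy U (0 : Site 4 8) 0 1)).trace.re) *
            wilsonExpectation (d := 4) (L := 8) ρ β (fun U => (N : ℝ) -
              (ρ (plaquetteHolonomy U (Pi.single (2 : Fin 4) (((1 : ℕ) : ℕ) : ZMod 8)) 0 1)).trace.re)
        ≤ M₁ * Real.exp (-(β * δ)) ^ 8 ∧
      δ ^ 2 * Real.exp (-(β * δ)) ^ 6 / 2 - M₂ * Real.exp (-(β * δ)) ^ 8 ≤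
        wilsonExpectation (d := 4) (L := 8) ρ β (fun U =>
            ((N : ℝ) - (ρ (plaquetteHolonomy U (0 : Site 4 8) 0 2)).trace.re) *
              ((N : ℝ) - (ρ (plaquetteHolonomy U (Pi.single (2 : Fin 4) (1 : ZMod 8)) 0 1)).trace.re)) -
          wilsonExpectation (d := 4) (L := 8) ρ β
              (fun U => (N : ℝ) - (ρ (plaquetteHolonomy U (0 : Site 4 8) 0 2)).trace.re) *
            wilsonExpectation (d := 4) (L := 8) ρ β (fun U => (N : ℝ) -
              (ρ (plaquetteHolonomy U (Pi.single (2 : Fin 4) (1 : ZMod 8)) 0 1)).trace.re) := by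
  classical
  -- Wilson expectations of functions of the plaquette field are exact-ensemble averages
  have wilsonExpectation_plaqField : ∀ (β : ℝ) (f : (Plaquette 4 8 → Additive G) → ℝ),
      wilsonExpectation (d := 4) (L := 8) ρ β (fun U => f (plaqField U)) =
        (∑ η ∈ Img 4 8 G, Wt (wilsonPhi ρ β) η * f η) / ∑ η ∈ Img 4 8 G, Wt (wilsonPhi ρ β) η := by
    intro β f
    rw [wilsonExpectation_eq_gibbsAverage ρ continuous_of_discreteTopology β,
      gibbsAverage_eq_exactAvgR (wilsonPhi ρ β) (w := fun U => Real.exp (-β * wilsonAction ρ U))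
        (fun U => exp_neg_mul_wilsonAction ρ β U) f]
    rfl
  -- the plaquette observable through the plaquette field (`i < j`)
  have gap_plaq : ∀ (U : GaugeConfig 4 8 G) (x : Site 4 8) {i j : Fin 4} (hij : i < j),
      (N : ℝ) - (ρ (plaquetteHolonomy U x i j)).trace.re =
        (N : ℝ) - (ρ (Additive.toMul (plaqField U (x, ⟨(i, j), hij⟩)))).trace.re := by
    intro U x i j hij
    rw [plaqField_apply, toMul_ofMul]
  -- the minimal action gap `δ = N - Re tr ρ(g₀)` over `g ≠ 1`, attained at `g₀`
  obtain ⟨g₀, hg₀, hmin⟩ := Finset.exists_min_image (Finset.univ.filter fun g : G => g ≠ 1)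
    (fun g => (N : ℝ) - (ρ g).trace.re) (by
      obtain ⟨a, ha⟩ := exists_ne (1 : G)
      exact ⟨a, Finset.mem_filter.2 ⟨Finset.mem_univ _, ha⟩⟩)
  have hg₀1 : g₀ ≠ 1 := (Finset.mem_filter.1 hg₀).2
  set δ : ℝ := (N : ℝ) - (ρ g₀).trace.re with hδ
  have hgap : ∀ g : G, g ≠ 1 → δ ≤ (N : ℝ) - (ρ g).trace.re := fun g hg =>
    hmin g (Finset.mem_filter.2 ⟨Finset.mem_univ _, hg⟩)
  have hδ0 : 0 < δ := by
    rcases (gap_mem ρ hρu g₀).1.lt_or_eq with h | h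
    · exact h
    · exfalso
      have htr : (ρ g₀).trace.re = N := by linarith
      have h1 := Literature.Barriers.QuantumFields.eq_one_of_re_trace_eq (hρu g₀) htr
      exact hg₀1 (hρinj (by rw [h1, map_one]))
  -- constants
  set Pc : ℝ := ((Fintype.card (Plaquette 4 8) : ℕ) : ℝ) with hPc
  set A : ℝ := ((Fintype.card (Additive G) : ℕ) : ℝ) with hA
  set T : ℝ := 1 / (2 * (((cubeDeg 4 : ℝ) + 1) ^ 2)) with hT
  have hD0 : (0 : ℝ) < ((cubeDeg 4 : ℝ) + 1) ^ 2 := pow_pos (Nat.cast_add_one_pos _) 2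
  have hT0 : 0 < T := by rw [hT]; exact one_div_pos.2 (mul_pos two_pos hD0)
  have hsmallT : ((cubeDeg 4 : ℝ) + 1) ^ 2 * T ≤ 1 / 2 := by
    rw [hT, mul_one_div, div_le_iff₀ (mul_pos two_pos hD0)]; nlinarith
  have hPc0 : 0 ≤ Pc := Nat.cast_nonneg _
  have hA1 : 1 ≤ A := by
    rw [hA]; exact_mod_cast Fintype.card_pos
  have hA0 : 0 ≤ A := by linarith
  have hApos : 0 < A := by linarith
  have hN0 : (0 : ℝ) ≤ N := Nat.cast_nonneg N
  set C5 : ℝ := Pc * (2 * T) / T ^ 5 with hC5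
  set C8 : ℝ := Pc * (2 * T) / T ^ 8 with hC8
  have hC50 : 0 ≤ C5 := div_nonneg (mul_nonneg hPc0 (by linarith)) (pow_nonneg hT0.le _)
  have hC80 : 0 ≤ C8 := div_nonneg (mul_nonneg hPc0 (by linarith)) (pow_nonneg hT0.le _)
  have hN2 : (0 : ℝ) ≤ 8 * (N : ℝ) ^ 2 := by nlinarith [sq_nonneg (N : ℝ)]
  have hin : 0 ≤ C8 * A ^ 8 + C5 ^ 2 * A ^ 10 :=
    add_nonneg (mul_nonneg hC80 (pow_nonneg hA0 _)) (mul_nonneg (sq_nonneg _) (pow_nonneg hA0 _))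
  have hM2 : 0 ≤ 16 * (N : ℝ) ^ 2 * C5 ^ 2 * A ^ 10 :=
    mul_nonneg (mul_nonneg (by nlinarith [sq_nonneg (N : ℝ)]) (sq_nonneg _)) (pow_nonneg hA0 _)
  refine ⟨δ, 8 * (N : ℝ) ^ 2 * (C8 * A ^ 8 + C5 ^ 2 * A ^ 10), 16 * (N : ℝ) ^ 2 * C5 ^ 2 * A ^ 10,
    hδ0, mul_nonneg hN2 hin, hM2, ?_⟩
  have hT0' : T ≠ 0 := hT0.ne'
  have hA' : A ≠ 0 := hApos.ne'
  have hPc1 : Pc + 1 ≠ 0 := by linarith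
  -- freeze the constants (no unfolding of cardinalities below)
  clear_value Pc A T C5 C8
  -- `ε(β) = e^{-βδ} → 0`
  have hεt : Tendsto (fun β : ℝ => Real.exp (-(β * δ))) atTop (𝓝 0) := by
    have h1 : Tendsto (fun β : ℝ => -(β * δ)) atTop atBot :=
      tendsto_neg_atTop_atBot.comp (tendsto_id.atTop_mul_const hδ0)
    exact Real.tendsto_exp_atBot.comp h1
  have hev1 : ∀ᶠ β : ℝ in atTop, 0 ≤ β := eventually_ge_atTop 0
  have hPA : 0 < 4 * (Pc + 1) * A := mul_pos (by linarith) hApos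
  have hev2 : ∀ᶠ β : ℝ in atTop, Real.exp (-(β * δ)) < T / A :=
    hεt (Iio_mem_nhds (div_pos hT0 hApos))
  have hev3 : ∀ᶠ β : ℝ in atTop, Real.exp (-(β * δ)) < 1 / (4 * (Pc + 1) * A) :=
    hεt (Iio_mem_nhds (one_div_pos.2 hPA))
  filter_upwards [hev1, hev2, hev3] with β hβ hε2 hε3
  -- abbreviations at this `β`
  set ε : ℝ := Real.exp (-(β * δ)) with hε
  have hε0 : 0 < ε := Real.exp_pos _
  have hε1 : ε ≤ 1 := Real.exp_le_one_iff.2 (by nlinarith)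
  set φ : Additive G → ℝ := wilsonPhi ρ β with hφ
  have hφ0 : φ 0 = 1 := wilsonPhi_zero ρ β
  have hφn : ∀ a, 0 ≤ φ a := wilsonPhi_nonneg ρ β
  have hφε : ∀ a, a ≠ 0 → φ a ≤ ε := wilsonPhi_le_of_gap ρ hβ hgap
  set lam : ℝ := A * ε with hlam
  have hlam0 : 0 ≤ lam := mul_nonneg hA0 hε0.le
  have hlamT : lam ≤ T := by
    rw [hlam]; have := (lt_div_iff₀ hApos).1 hε2; linarith [mul_comm A ε]
  -- Peierls sums
  have hPS : ∀ M : ℕ, peierlsSum 4 8 lam M ≤ Pc * (2 * T) * (lam / T) ^ M := fun M => by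
    have h := peierlsSum_le_pow (d := 4) (L := 8) hlam0 hlamT hT0 hsmallT M
    rwa [← hPc] at h
  have hlam_lt : lam < 1 / (4 * (Pc + 1)) := by
    rw [hlam]
    calc A * ε < A * (1 / (4 * (Pc + 1) * A)) := mul_lt_mul_of_pos_left hε3 hApos
      _ = 1 / (4 * (Pc + 1)) := by field_simp
  have hPS1 : peierlsSum 4 8 lam 1 ≤ 1 / 2 := by
    refine (hPS 1).trans ?_
    have h1 : Pc * (2 * T) * (lam / T) ^ 1 = 2 * Pc * lam := by rw [pow_one]; field_simp
    rw [h1]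
    have h2 : 2 * Pc * lam ≤ 2 * (Pc + 1) * lam := by nlinarith
    have h3 : 2 * (Pc + 1) * lam < 2 * (Pc + 1) * (1 / (4 * (Pc + 1))) :=
      mul_lt_mul_of_pos_left hlam_lt (by linarith)
    have h4 : 2 * (Pc + 1) * (1 / (4 * (Pc + 1))) = 1 / 2 := by field_simp; ring
    linarith
  have hPS5 : peierlsSum 4 8 lam 5 ≤ C5 * lam ^ 5 := by
    refine (hPS 5).trans (le_of_eq ?_)
    rw [hC5, div_pow, div_mul_eq_mul_div, mul_div_assoc]
  have hPS8 : peierlsSum 4 8 lam 8 ≤ C8 * lam ^ 8 := by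
    refine (hPS 8).trans (le_of_eq ?_)
    rw [hC8, div_pow, div_mul_eq_mul_div, mul_div_assoc]
  have hPS50 : 0 ≤ peierlsSum 4 8 lam 5 := peierlsSum_nonneg hlam0 5
  -- partition sums
  have hPS1' : peierlsSum 4 8 (Fintype.card (Additive G) * ε) 1 ≤ 1 / 2 := by
    rw [← hA, ← hlam]; exact hPS1
  have hZc2 : ∑ η ∈ Closed 4 8 (Additive G), Wt φ η ≤ 2 :=
    sum_closed_le_two hφ0 hφn hε0.le hφε hPS1'
  have hZex1 : 1 ≤ ∑ η ∈ Img 4 8 G, Wt φ η := one_le_sum_Img hφ0 hφn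
  have hZex2 : ∑ η ∈ Img 4 8 G, Wt φ η ≤ 2 := (sum_Img_le_sum_closed hφn).trans hZc2
  have hZex0 : 0 < ∑ η ∈ Img 4 8 G, Wt φ η := by linarith only [hZex1]
  have hZc0 : 0 ≤ ∑ η ∈ Closed 4 8 (Additive G), Wt φ η := by
    linarith only [hZex1, sum_Img_le_sum_closed (d := 4) (L := 8) (G := G) hφn]
  -- rewrite the four expectations through the plaquette field
  have hsing : (Pi.single (2 : Fin 4) (((1 : ℕ) : ℕ) : ZMod 8) : Site 4 8) = te 2 := by
    simp [te]
  have hsing' : (Pi.single (2 : Fin 4) (1 : ZMod 8) : Site 4 8) = te 2 := rfl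
  simp only [hsing, hsing']
  have eP0P1 : (fun U : GaugeConfig 4 8 G =>
      ((N : ℝ) - (ρ (plaquetteHolonomy U (0 : Site 4 8) 0 1)).trace.re) *
        ((N : ℝ) - (ρ (plaquetteHolonomy U (te 2 : Site 4 8) 0 1)).trace.re)) =
      fun U => (fun η : Plaquette 4 8 → Additive G =>
        ((N : ℝ) - (ρ (Additive.toMul (η ((0 : Site 4 8), ⟨(0, 1), h01⟩)))).trace.re) *
          ((N : ℝ) - (ρ (Additive.toMul (η ((te 2 : Site 4 8), ⟨(0, 1), h01⟩)))).trace.re))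
        (plaqField U) := by
    funext U; rw [gap_plaq U 0 h01, gap_plaq U (te 2) h01]
  have eP0 : (fun U : GaugeConfig 4 8 G =>
      (N : ℝ) - (ρ (plaquetteHolonomy U (0 : Site 4 8) 0 1)).trace.re) =
      fun U => (fun η : Plaquette 4 8 → Additive G =>
        (N : ℝ) - (ρ (Additive.toMul (η ((0 : Site 4 8), ⟨(0, 1), h01⟩)))).trace.re) (plaqField U) := by
    funext U; rw [gap_plaq U 0 h01]
  have eP1 : (fun U : GaugeConfig 4 8 G =>
      (N : ℝ) - (ρ (plaquetteHolonomy U (te 2 : Site 4 8) 0 1)).trace.re) =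
      fun U => (fun η : Plaquette 4 8 → Additive G =>
        (N : ℝ) - (ρ (Additive.toMul (η ((te 2 : Site 4 8), ⟨(0, 1), h01⟩)))).trace.re)
        (plaqField U) := by
    funext U; rw [gap_plaq U (te 2) h01]
  have eQ0P1 : (fun U : GaugeConfig 4 8 G =>
      ((N : ℝ) - (ρ (plaquetteHolonomy U (0 : Site 4 8) 0 2)).trace.re) *
        ((N : ℝ) - (ρ (plaquetteHolonomy U (te 2 : Site 4 8) 0 1)).trace.re)) =
      fun U => (fun η : Plaquette 4 8 → Additive G =>
        ((N : ℝ) - (ρ (Additive.toMul (η ((0 : Site 4 8), ⟨(0, 2), h02⟩)))).trace.re) *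
          ((N : ℝ) - (ρ (Additive.toMul (η ((te 2 : Site 4 8), ⟨(0, 1), h01⟩)))).trace.re))
        (plaqField U) := by
    funext U; rw [gap_plaq U 0 h02, gap_plaq U (te 2) h01]
  have eQ0 : (fun U : GaugeConfig 4 8 G =>
      (N : ℝ) - (ρ (plaquetteHolonomy U (0 : Site 4 8) 0 2)).trace.re) =
      fun U => (fun η : Plaquette 4 8 → Additive G =>
        (N : ℝ) - (ρ (Additive.toMul (η ((0 : Site 4 8), ⟨(0, 2), h02⟩)))).trace.re) (plaqField U) := by
    funext U; rw [gap_plaq U 0 h02]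
  rw [eP0P1, eP0, eP1, eQ0P1, eQ0]
  rw [wilsonExpectation_plaqField β (fun η : Plaquette 4 8 → Additive G =>
        ((N : ℝ) - (ρ (Additive.toMul (η ((0 : Site 4 8), ⟨(0, 1), h01⟩)))).trace.re) *
          ((N : ℝ) - (ρ (Additive.toMul (η ((te 2 : Site 4 8), ⟨(0, 1), h01⟩)))).trace.re)),
    wilsonExpectation_plaqField β (fun η : Plaquette 4 8 → Additive G =>
        (N : ℝ) - (ρ (Additive.toMul (η ((0 : Site 4 8), ⟨(0, 1), h01⟩)))).trace.re),
    wilsonExpectation_plaqField β (fun η : Plaquette 4 8 → Additive G =>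
        (N : ℝ) - (ρ (Additive.toMul (η ((te 2 : Site 4 8), ⟨(0, 1), h01⟩)))).trace.re),
    wilsonExpectation_plaqField β (fun η : Plaquette 4 8 → Additive G =>
        ((N : ℝ) - (ρ (Additive.toMul (η ((0 : Site 4 8), ⟨(0, 2), h02⟩)))).trace.re) *
          ((N : ℝ) - (ρ (Additive.toMul (η ((te 2 : Site 4 8), ⟨(0, 1), h01⟩)))).trace.re)),
    wilsonExpectation_plaqField β (fun η : Plaquette 4 8 → Additive G =>
        (N : ℝ) - (ρ (Additive.toMul (η ((0 : Site 4 8), ⟨(0, 2), h02⟩)))).trace.re)]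
  -- the numerators and their bounds
  set Zex := ∑ η ∈ Img 4 8 G, Wt φ η with hZexdef
  set Zc := ∑ η ∈ Closed 4 8 (Additive G), Wt φ η with hZcdef
  set nA := ∑ η ∈ Img 4 8 G, Wt φ η *
    (((N : ℝ) - (ρ (Additive.toMul (η ((0 : Site 4 8), ⟨(0, 1), h01⟩)))).trace.re) *
      ((N : ℝ) - (ρ (Additive.toMul (η ((te 2 : Site 4 8), ⟨(0, 1), h01⟩)))).trace.re)) with hnAdef
  set n0 := ∑ η ∈ Img 4 8 G, Wt φ η *
    ((N : ℝ) - (ρ (Additive.toMul (η ((0 : Site 4 8), ⟨(0, 1), h01⟩)))).trace.re) with hn0def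
  set n1 := ∑ η ∈ Img 4 8 G, Wt φ η *
    ((N : ℝ) - (ρ (Additive.toMul (η ((te 2 : Site 4 8), ⟨(0, 1), h01⟩)))).trace.re) with hn1def
  set nQ := ∑ η ∈ Img 4 8 G, Wt φ η *
    (((N : ℝ) - (ρ (Additive.toMul (η ((0 : Site 4 8), ⟨(0, 2), h02⟩)))).trace.re) *
      ((N : ℝ) - (ρ (Additive.toMul (η ((te 2 : Site 4 8), ⟨(0, 1), h01⟩)))).trace.re)) with hnQdef
  set nq := ∑ η ∈ Img 4 8 G, Wt φ η *
    ((N : ℝ) - (ρ (Additive.toMul (η ((0 : Site 4 8), ⟨(0, 2), h02⟩)))).trace.re) with hnqdef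
  have hgn : ∀ a : Additive G, 0 ≤ (N : ℝ) - (ρ (Additive.toMul a)).trace.re := fun a =>
    (gap_mem ρ hρu _).1
  have hnA0 : 0 ≤ nA := Finset.sum_nonneg fun η _ =>
    mul_nonneg (Wt_nonneg hφn η) (mul_nonneg (hgn _) (hgn _))
  have hn00 : 0 ≤ n0 := Finset.sum_nonneg fun η _ => mul_nonneg (Wt_nonneg hφn η) (hgn _)
  have hn10 : 0 ≤ n1 := Finset.sum_nonneg fun η _ => mul_nonneg (Wt_nonneg hφn η) (hgn _)
  have hnQ0 : 0 ≤ nQ := Finset.sum_nonneg fun η _ =>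
    mul_nonneg (Wt_nonneg hφn η) (mul_nonneg (hgn _) (hgn _))
  have hnq0 : 0 ≤ nq := Finset.sum_nonneg fun η _ => mul_nonneg (Wt_nonneg hφn η) (hgn _)
  have hnA' : nA ≤ 4 * (N : ℝ) ^ 2 * (Zc * (peierlsSum 4 8 lam 8 + peierlsSum 4 8 lam 5 ^ 2)) := by
    have h := sum_Img_axis_le ρ hρu hφ0 hφn hε0.le hφε
    rw [← hA, ← hlam] at h
    exact h
  have hnq' : nq ≤ 2 * (N : ℝ) * (Zc * peierlsSum 4 8 lam 5) := by
    have h := sum_Img_q0_le ρ hρu hφ0 hφn hε0.le hφε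
    rw [← hA, ← hlam] at h
    exact h
  have hn1' : n1 ≤ 2 * (N : ℝ) * (Zc * peierlsSum 4 8 lam 5) := by
    have h := sum_Img_p1_le ρ hρu hφ0 hφn hε0.le hφε
    rw [← hA, ← hlam] at h
    exact h
  have hnQ : δ ^ 2 * ε ^ 6 ≤ nQ := sum_Img_pair_ge ρ hρu hβ g₀
  -- freeze the sums: pure real arithmetic from here on
  clear_value Zex Zc nA n0 n1 nQ nq
  clear eP0P1 eP0 eP1 eQ0P1 eQ0 hsing hsing' hPS hmin hgap hφε hgn
  set P5 := peierlsSum 4 8 lam 5 with hP5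
  set P8 := peierlsSum 4 8 lam 8 with hP8
  have hP80 : 0 ≤ P8 := by rw [hP8]; exact peierlsSum_nonneg hlam0 8
  clear_value P5 P8
  have hl8 : lam ^ 8 = A ^ 8 * ε ^ 8 := by rw [hlam, mul_pow]
  have hl10 : lam ^ 10 ≤ A ^ 10 * ε ^ 8 := by
    rw [hlam, mul_pow]
    exact mul_le_mul_of_nonneg_left (pow_le_pow_of_le_one hε0.le hε1 (by norm_num))
      (pow_nonneg hA0 _)
  -- (s1) the axis numerator
  have hW0 : 0 ≤ C8 * lam ^ 8 + C5 ^ 2 * lam ^ 10 :=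
    add_nonneg (mul_nonneg hC80 (pow_nonneg hlam0 _)) (mul_nonneg (sq_nonneg _) (pow_nonneg hlam0 _))
  have hsq : P5 ^ 2 ≤ (C5 * lam ^ 5) ^ 2 := pow_le_pow_left₀ hPS50 hPS5 2
  have hsq' : (C5 * lam ^ 5) ^ 2 = C5 ^ 2 * lam ^ 10 := by ring
  have h2 : P8 + P5 ^ 2 ≤ C8 * lam ^ 8 + C5 ^ 2 * lam ^ 10 := by linarith only [hPS8, hsq, hsq']
  have h3 : 0 ≤ P8 + P5 ^ 2 := add_nonneg hP80 (sq_nonneg _)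
  have hZW : Zc * (P8 + P5 ^ 2) ≤ 2 * (C8 * lam ^ 8 + C5 ^ 2 * lam ^ 10) :=
    mul_le_mul hZc2 h2 h3 (by norm_num)
  have h4N2 : 0 ≤ 4 * (N : ℝ) ^ 2 := by nlinarith only [sq_nonneg (N : ℝ)]
  have hnA : nA ≤ 8 * (N : ℝ) ^ 2 * (C8 * lam ^ 8 + C5 ^ 2 * lam ^ 10) := by
    have := mul_le_mul_of_nonneg_left hZW h4N2
    linarith only [hnA', this]
  -- (s2, s3) the one-plaquette numerators
  have hZP : Zc * P5 ≤ 2 * (C5 * lam ^ 5) := mul_le_mul hZc2 hPS5 hPS50 (by norm_num)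
  have h2N : 0 ≤ 2 * (N : ℝ) := by linarith only [hN0]
  have hnq : nq ≤ 4 * (N : ℝ) * (C5 * lam ^ 5) := by
    have := mul_le_mul_of_nonneg_left hZP h2N
    linarith only [hnq', this]
  have hn1 : n1 ≤ 4 * (N : ℝ) * (C5 * lam ^ 5) := by
    have := mul_le_mul_of_nonneg_left hZP h2N
    linarith only [hn1', this]
  -- (s4) expectations
  have hEA : nA / Zex ≤ nA := div_le_self hnA0 hZex1
  have hEQ : δ ^ 2 * ε ^ 6 / 2 ≤ nQ / Zex :=
    (div_le_div_of_nonneg_right (c := 2) hnQ (by norm_num)).trans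
      (div_le_div_of_nonneg_left hnQ0 hZex0 hZex2)
  have hEq : nq / Zex ≤ 4 * (N : ℝ) * (C5 * lam ^ 5) := (div_le_self hnq0 hZex1).trans hnq
  have hE1 : n1 / Zex ≤ 4 * (N : ℝ) * (C5 * lam ^ 5) := (div_le_self hn10 hZex1).trans hn1
  have hEq0 : 0 ≤ nq / Zex := div_nonneg hnq0 hZex0.le
  have hE10 : 0 ≤ n1 / Zex := div_nonneg hn10 hZex0.le
  have hE00 : 0 ≤ n0 / Zex := div_nonneg hn00 hZex0.le
  -- (s5) the axis side is `≤ ε⁸ M₁`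
  have hWε : C8 * lam ^ 8 + C5 ^ 2 * lam ^ 10 ≤ ε ^ 8 * (C8 * A ^ 8 + C5 ^ 2 * A ^ 10) := by
    rw [hl8]
    have := mul_le_mul_of_nonneg_left hl10 (sq_nonneg C5)
    nlinarith only [this]
  have hleft : nA / Zex - n0 / Zex * (n1 / Zex) ≤
      8 * (N : ℝ) ^ 2 * (C8 * A ^ 8 + C5 ^ 2 * A ^ 10) * ε ^ 8 := by
    have h1 : nA / Zex - n0 / Zex * (n1 / Zex) ≤ nA := by
      have := mul_nonneg hE00 hE10
      linarith only [hEA, this]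
    have h8N : 0 ≤ 8 * (N : ℝ) ^ 2 := by linarith only [h4N2]
    have h2 : nA ≤ ε ^ 8 * (8 * (N : ℝ) ^ 2 * (C8 * A ^ 8 + C5 ^ 2 * A ^ 10)) := by
      have := mul_le_mul_of_nonneg_left hWε h8N
      linarith only [hnA, this]
    linarith only [h1, h2]
  -- (s6) the pair side is `≥ δ² ε⁶ / 2 - ε⁸ M₂`
  have h4N : 0 ≤ 4 * (N : ℝ) * (C5 * lam ^ 5) :=
    mul_nonneg (by linarith only [hN0]) (mul_nonneg hC50 (pow_nonneg hlam0 _))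
  have hprod : nq / Zex * (n1 / Zex) ≤ (4 * (N : ℝ) * (C5 * lam ^ 5)) ^ 2 := by
    rw [sq]; exact mul_le_mul hEq hE1 hE10 h4N
  have hsq10 : (4 * (N : ℝ) * (C5 * lam ^ 5)) ^ 2 ≤ ε ^ 8 * (16 * (N : ℝ) ^ 2 * C5 ^ 2 * A ^ 10) := by
    have e1 : (4 * (N : ℝ) * (C5 * lam ^ 5)) ^ 2 = (16 * (N : ℝ) ^ 2 * C5 ^ 2) * lam ^ 10 := by ring
    rw [e1]
    have h16 : (0 : ℝ) ≤ 16 * (N : ℝ) ^ 2 * C5 ^ 2 :=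
      mul_nonneg (by linarith only [h4N2]) (sq_nonneg C5)
    calc (16 * (N : ℝ) ^ 2 * C5 ^ 2) * lam ^ 10 ≤ (16 * (N : ℝ) ^ 2 * C5 ^ 2) * (A ^ 10 * ε ^ 8) :=
          mul_le_mul_of_nonneg_left hl10 h16
      _ = ε ^ 8 * (16 * (N : ℝ) ^ 2 * C5 ^ 2 * A ^ 10) := by ring
  have hright : δ ^ 2 * ε ^ 6 / 2 - 16 * (N : ℝ) ^ 2 * C5 ^ 2 * A ^ 10 * ε ^ 8 ≤
      nQ / Zex - nq / Zex * (n1 / Zex) := by linarith only [hEQ, hprod, hsq10]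
  exact ⟨by linarith only [hleft], by linarith only [hright]⟩

end Summit.QuantumFields.YangMills.Theorems.FemtoCurvatureTwoPoint.Negative.FiniteGroupSharedLink

end
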